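import Summits.CriticalPhenomena.SAWScalingLimit.Theorems.SAWWeldingIdentificationWeldingSetupSignCore
import Summits.CriticalPhenomena.SAWScalingLimit.Theorems.SAWWeldingIdentificationWeldingSetupBanks

/-!
# The sign of a welding configuration is the orientation of the four-marked domain
# (route `SAWWeldingIdentification`, helper for item `WeldingSetup`, stmt-CriticalPhenomena-4504)

Fix a conformal rectangle `Q = (Ω; a, c_L, b, c_R)` and a chordal uniformiser
`Φ : (ℍ; 0, ∞) → (Ω; a, b)` of `Q.chord 0 2`; let `t_L` be the (nonzero) real point with
`Φ(t_L) = c_L`. For a simple chord `γ` of `(Ω; a, b)` with banks `L ∋̄ c_L`, `R ∋̄ c_R` and chordal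
uniformisers `φ : ℍ → L`, `ψ : ℍ → R` (`0 ↦ a`, `∞ ↦ b`) we prove the ORIENTATION RULE: the real
point of `φ` over `c_L` has the sign of `t_L`, and the real point of `ψ` over `c_R` has the
opposite sign (`sign_left_pos`, `sign_left_neg`, `sign_right_pos`, `sign_right_neg`). Hence in the
route's welding configurations `(s, L, R, φ, ψ)` (normalisation `φ(s) = c_L`, `ψ(-s) = c_R`) the
sign `s` is forced: `s = 1` if `t_L > 0` and `s = -1` if `t_L < 0`, for EVERY chord — which is the
existential "`∃ s`, for all chords" of item `WeldingSetup` (i) and the sign half of configuration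
independence in (ii).

Proof (`false_of_image_Iio_subset_image_Ioi`, `false_of_image_Ioi_subset_image_Iio`): for nested
Dobrushin domains `D ⊆ E` with the same first marked point, the holomorphic map
`g = Φ_E⁻¹ ∘ φ_D : ℍ → ℍ` has boundary value `0` at `0` and real boundary values along any real
half-line that `φ_D` sends into `Φ_E(ℝ)`; by the boundary monotonicity lemma
(`strictMonoOn_boundary_of_mapsTo_upperHalfPlane`, Schwarz reflection) these increase, which is
incompatible with `φ_D((-∞,0)) ⊆ Φ_E((0,∞))` or `φ_D((0,∞)) ⊆ Φ_E((-∞,0))`. The half-line images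
are identified with boundary arcs by `image_Ioi_eq_of_mem` / `image_Iio_eq_of_mem`.

References: Ch. Pommerenke, *Boundary Behaviour of Conformal Maps* (1992), Thm. 2.6 and §2.3.
-/

noncomputable section

namespace Summit.CriticalPhenomena.SAWScalingLimit.Theorems

open Set Filter Topology Complex Metric Function
open UpperHalfPlane (upperHalfPlaneSet)
open Literature.Probability.RandomPlanarGeometry Literature.Topology.PlaneTopology

/-! ### The orientation rule for the banks of a chord -/

section Banks

variable {Q : ConformalRectangle} {γ : CurveClass ℂ}
  (hγ : (Q.chord 0 2 (by decide)).IsSimpleChord γ)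
  (Φ : ConformalEquiv upperHalfPlaneSet (Q.chord 0 2 (by decide)).carrier)
  (hΦ : (Q.chord 0 2 (by decide)).IsChordalUniformizing Φ)
  {tL : ℝ} (htL : Φ.boundaryExtension tL = Q.pt 1)

include hΦ htL in
/-- If `Φ(t_L) = c_L` with `t_L > 0`, the positive half-line goes onto the arc through `c_L` and
the negative one onto the arc through `c_R`. [folklore] -/
theorem image_halfLines_of_pos (ht : 0 < tL) :
    (fun t : ℝ => Φ.boundaryExtension t) '' Ioi 0 = Q.boundary '' Ioo (Q.mark 0) (Q.mark 2) ∧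
      (fun t : ℝ => Φ.boundaryExtension t) '' Iio 0 = Q.boundary '' Ioo (Q.mark 2) (Q.mark 0 + 1) :=
  image_Ioi_eq_of_mem Φ hΦ (frontier_diff_eq_arcs Q) (disjoint_closure_arc_left_arc_right Q)
    (disjoint_arc_left_closure_arc_right Q) ⟨_, pt_one_mem_arc Q⟩ ⟨_, pt_three_mem_arc Q⟩ ht
    (htL ▸ pt_one_mem_arc Q)

include hΦ htL in
/-- If `Φ(t_L) = c_L` with `t_L < 0`, the negative half-line goes onto the arc through `c_L` and
the positive one onto the arc through `c_R`. [folklore] -/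
theorem image_halfLines_of_neg (ht : tL < 0) :
    (fun t : ℝ => Φ.boundaryExtension t) '' Iio 0 = Q.boundary '' Ioo (Q.mark 0) (Q.mark 2) ∧
      (fun t : ℝ => Φ.boundaryExtension t) '' Ioi 0 = Q.boundary '' Ioo (Q.mark 2) (Q.mark 0 + 1) :=
  image_Iio_eq_of_mem Φ hΦ (frontier_diff_eq_arcs Q) (disjoint_closure_arc_left_arc_right Q)
    (disjoint_arc_left_closure_arc_right Q) ⟨_, pt_one_mem_arc Q⟩ ⟨_, pt_three_mem_arc Q⟩ ht
    (htL ▸ pt_one_mem_arc Q)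

/-- The bank clause of the route (eight conditions on `(L, R)`), abbreviated in statements
below by spelling it out; this lemma extracts `L ⊆ Ω`. [folklore] -/
theorem left_subset_carrier {L R : Set ℂ}
    (h : L ∪ R = Q.carrier \ γ.range ∧ Disjoint L R ∧ IsOpen L ∧ IsOpen R ∧ IsConnected L ∧
      IsConnected R ∧ Q.pt 1 ∈ closure L ∧ Q.pt 3 ∈ closure R) : L ⊆ Q.carrier := fun z hz => by
  have h' : z ∈ L ∪ R := Or.inl hz
  rw [h.1] at h'
  exact h'.1

/-- The bank clause gives `R ⊆ Ω`. [folklore] -/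
theorem right_subset_carrier {L R : Set ℂ}
    (h : L ∪ R = Q.carrier \ γ.range ∧ Disjoint L R ∧ IsOpen L ∧ IsOpen R ∧ IsConnected L ∧
      IsConnected R ∧ Q.pt 1 ∈ closure L ∧ Q.pt 3 ∈ closure R) : R ⊆ Q.carrier := fun z hz => by
  have h' : z ∈ L ∪ R := Or.inr hz
  rw [h.1] at h'
  exact h'.1

include hγ in
/-- **Half-lines of a chordal uniformiser of the LEFT bank.** If `φ : ℍ → L` has boundary values
`a` at `0`, `b` at `∞` and `c_L` at a real `s > 0`, then `φ` carries `(0, ∞)` onto the open arc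
`A_L` and `(-∞, 0)` onto the open chord `γ°`. [folklore] -/
theorem image_halfLines_left_of_pos {L R : Set ℂ}
    (h : L ∪ R = Q.carrier \ γ.range ∧ Disjoint L R ∧ IsOpen L ∧ IsOpen R ∧ IsConnected L ∧
      IsConnected R ∧ Q.pt 1 ∈ closure L ∧ Q.pt 3 ∈ closure R)
    (φ : ConformalEquiv upperHalfPlaneSet L) (hφ0 : φ.HasBoundaryValue 0 (Q.pt 0))
    (hφi : φ.HasBoundaryValueAtInfty (Q.pt 2)) {s : ℝ} (hs0 : 0 < s)
    (hs : φ.HasBoundaryValue s (Q.pt 1)) :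
    (fun t : ℝ => φ.boundaryExtension t) '' Ioi 0 = Q.boundary '' Ioo (Q.mark 0) (Q.mark 2) ∧
      (fun t : ℝ => φ.boundaryExtension t) '' Iio 0 = γ.range \ {Q.pt 0, Q.pt 2} := by
  obtain ⟨p, hp, hpinj, hprange, hp0, hp1⟩ := exists_param_of_isSimpleChord hγ
  obtain ⟨D, hDL, hDa, hDb, -⟩ := exists_leftBank_dobrushinDomain hγ h hp hpinj hprange hp0 hp1
  subst hDL
  have hφ : D.IsChordalUniformizing φ := ⟨by rw [hDa]; exact hφ0, by rw [hDb]; exact hφi⟩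
  have hfr := (frontier_banks_eq hγ h).1
  have hAB : Q.boundary '' Ioo (Q.mark 0) (Q.mark 2) ∪ (γ.range \ {Q.pt 0, Q.pt 2}) =
      frontier D.carrier \ {D.pt 0, D.pt 1} := by
    rw [hDa, hDb]; exact frontier_left_diff_eq (Q := Q) (γ := γ) hfr
  exact image_Ioi_eq_of_mem φ hφ hAB (disjoint_closure_arc_left_range_diff hγ)
    (disjoint_arc_left_closure_range_diff hγ) ⟨_, pt_one_mem_arc Q⟩ (range_diff_nonempty hγ) hs0
    ((JordanDomain.boundaryExtension_eq_of_hasBoundaryValue' φ (by simp) hs).symm ▸ pt_one_mem_arc Q)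

include hγ in
/-- Half-lines of a chordal uniformiser of the left bank, `s < 0`: `(-∞, 0) ↦ A_L`,
`(0, ∞) ↦ γ°`. [folklore] -/
theorem image_halfLines_left_of_neg {L R : Set ℂ}
    (h : L ∪ R = Q.carrier \ γ.range ∧ Disjoint L R ∧ IsOpen L ∧ IsOpen R ∧ IsConnected L ∧
      IsConnected R ∧ Q.pt 1 ∈ closure L ∧ Q.pt 3 ∈ closure R)
    (φ : ConformalEquiv upperHalfPlaneSet L) (hφ0 : φ.HasBoundaryValue 0 (Q.pt 0))
    (hφi : φ.HasBoundaryValueAtInfty (Q.pt 2)) {s : ℝ} (hs0 : s < 0)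
    (hs : φ.HasBoundaryValue s (Q.pt 1)) :
    (fun t : ℝ => φ.boundaryExtension t) '' Iio 0 = Q.boundary '' Ioo (Q.mark 0) (Q.mark 2) ∧
      (fun t : ℝ => φ.boundaryExtension t) '' Ioi 0 = γ.range \ {Q.pt 0, Q.pt 2} := by
  obtain ⟨p, hp, hpinj, hprange, hp0, hp1⟩ := exists_param_of_isSimpleChord hγ
  obtain ⟨D, hDL, hDa, hDb, -⟩ := exists_leftBank_dobrushinDomain hγ h hp hpinj hprange hp0 hp1
  subst hDL
  have hφ : D.IsChordalUniformizing φ := ⟨by rw [hDa]; exact hφ0, by rw [hDb]; exact hφi⟩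
  have hfr := (frontier_banks_eq hγ h).1
  have hAB : Q.boundary '' Ioo (Q.mark 0) (Q.mark 2) ∪ (γ.range \ {Q.pt 0, Q.pt 2}) =
      frontier D.carrier \ {D.pt 0, D.pt 1} := by
    rw [hDa, hDb]; exact frontier_left_diff_eq (Q := Q) (γ := γ) hfr
  exact image_Iio_eq_of_mem φ hφ hAB (disjoint_closure_arc_left_range_diff hγ)
    (disjoint_arc_left_closure_range_diff hγ) ⟨_, pt_one_mem_arc Q⟩ (range_diff_nonempty hγ) hs0
    ((JordanDomain.boundaryExtension_eq_of_hasBoundaryValue' φ (by simp) hs).symm ▸ pt_one_mem_arc Q)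

include hγ in
/-- **Half-lines of a chordal uniformiser of the RIGHT bank**, `s > 0` over `c_R`:
`(0, ∞) ↦ A_R`, `(-∞, 0) ↦ γ°`. [folklore] -/
theorem image_halfLines_right_of_pos {L R : Set ℂ}
    (h : L ∪ R = Q.carrier \ γ.range ∧ Disjoint L R ∧ IsOpen L ∧ IsOpen R ∧ IsConnected L ∧
      IsConnected R ∧ Q.pt 1 ∈ closure L ∧ Q.pt 3 ∈ closure R)
    (ψ : ConformalEquiv upperHalfPlaneSet R) (hψ0 : ψ.HasBoundaryValue 0 (Q.pt 0))
    (hψi : ψ.HasBoundaryValueAtInfty (Q.pt 2)) {s : ℝ} (hs0 : 0 < s)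
    (hs : ψ.HasBoundaryValue s (Q.pt 3)) :
    (fun t : ℝ => ψ.boundaryExtension t) '' Ioi 0 = Q.boundary '' Ioo (Q.mark 2) (Q.mark 0 + 1) ∧
      (fun t : ℝ => ψ.boundaryExtension t) '' Iio 0 = γ.range \ {Q.pt 0, Q.pt 2} := by
  obtain ⟨p, hp, hpinj, hprange, hp0, hp1⟩ := exists_param_of_isSimpleChord hγ
  obtain ⟨D, hDR, hDa, hDb, -⟩ := exists_rightBank_dobrushinDomain hγ h hp hpinj hprange hp0 hp1
  subst hDR
  have hψ : D.IsChordalUniformizing ψ := ⟨by rw [hDa]; exact hψ0, by rw [hDb]; exact hψi⟩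
  have hfr := (frontier_banks_eq hγ h).2
  have hAB : Q.boundary '' Ioo (Q.mark 2) (Q.mark 0 + 1) ∪ (γ.range \ {Q.pt 0, Q.pt 2}) =
      frontier D.carrier \ {D.pt 0, D.pt 1} := by
    rw [hDa, hDb]; exact frontier_right_diff_eq (Q := Q) (γ := γ) hfr
  exact image_Ioi_eq_of_mem ψ hψ hAB (disjoint_closure_arc_right_range_diff hγ)
    (disjoint_arc_right_closure_range_diff hγ) ⟨_, pt_three_mem_arc Q⟩ (range_diff_nonempty hγ) hs0
    ((JordanDomain.boundaryExtension_eq_of_hasBoundaryValue' ψ (by simp) hs).symm ▸ pt_three_mem_arc Q)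

include hγ in
/-- Half-lines of a chordal uniformiser of the right bank, `s < 0` over `c_R`: `(-∞, 0) ↦ A_R`,
`(0, ∞) ↦ γ°`. [folklore] -/
theorem image_halfLines_right_of_neg {L R : Set ℂ}
    (h : L ∪ R = Q.carrier \ γ.range ∧ Disjoint L R ∧ IsOpen L ∧ IsOpen R ∧ IsConnected L ∧
      IsConnected R ∧ Q.pt 1 ∈ closure L ∧ Q.pt 3 ∈ closure R)
    (ψ : ConformalEquiv upperHalfPlaneSet R) (hψ0 : ψ.HasBoundaryValue 0 (Q.pt 0))
    (hψi : ψ.HasBoundaryValueAtInfty (Q.pt 2)) {s : ℝ} (hs0 : s < 0)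
    (hs : ψ.HasBoundaryValue s (Q.pt 3)) :
    (fun t : ℝ => ψ.boundaryExtension t) '' Iio 0 = Q.boundary '' Ioo (Q.mark 2) (Q.mark 0 + 1) ∧
      (fun t : ℝ => ψ.boundaryExtension t) '' Ioi 0 = γ.range \ {Q.pt 0, Q.pt 2} := by
  obtain ⟨p, hp, hpinj, hprange, hp0, hp1⟩ := exists_param_of_isSimpleChord hγ
  obtain ⟨D, hDR, hDa, hDb, -⟩ := exists_rightBank_dobrushinDomain hγ h hp hpinj hprange hp0 hp1
  subst hDR
  have hψ : D.IsChordalUniformizing ψ := ⟨by rw [hDa]; exact hψ0, by rw [hDb]; exact hψi⟩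
  have hfr := (frontier_banks_eq hγ h).2
  have hAB : Q.boundary '' Ioo (Q.mark 2) (Q.mark 0 + 1) ∪ (γ.range \ {Q.pt 0, Q.pt 2}) =
      frontier D.carrier \ {D.pt 0, D.pt 1} := by
    rw [hDa, hDb]; exact frontier_right_diff_eq (Q := Q) (γ := γ) hfr
  exact image_Iio_eq_of_mem ψ hψ hAB (disjoint_closure_arc_right_range_diff hγ)
    (disjoint_arc_right_closure_range_diff hγ) ⟨_, pt_three_mem_arc Q⟩ (range_diff_nonempty hγ) hs0
    ((JordanDomain.boundaryExtension_eq_of_hasBoundaryValue' ψ (by simp) hs).symm ▸ pt_three_mem_arc Q)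

include hγ hΦ htL in
/-- **Orientation rule, left bank, `t_L > 0`**: if `φ : ℍ → L` has boundary values `a` at `0`,
`b` at `∞` and `c_L` at the real point `s`, then `s > 0`. [folklore] -/
theorem sign_left_pos {L R : Set ℂ}
    (h : L ∪ R = Q.carrier \ γ.range ∧ Disjoint L R ∧ IsOpen L ∧ IsOpen R ∧ IsConnected L ∧
      IsConnected R ∧ Q.pt 1 ∈ closure L ∧ Q.pt 3 ∈ closure R)
    (φ : ConformalEquiv upperHalfPlaneSet L) (hφ0 : φ.HasBoundaryValue 0 (Q.pt 0))
    (hφi : φ.HasBoundaryValueAtInfty (Q.pt 2)) (ht : 0 < tL) {s : ℝ}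
    (hs : φ.HasBoundaryValue s (Q.pt 1)) : 0 < s := by
  obtain ⟨p, hp, hpinj, hprange, hp0, hp1⟩ := exists_param_of_isSimpleChord hγ
  obtain ⟨D, hDL, hDa, hDb, -⟩ := exists_leftBank_dobrushinDomain hγ h hp hpinj hprange hp0 hp1
  subst hDL
  have hφ : D.IsChordalUniformizing φ := ⟨by rw [hDa]; exact hφ0, by rw [hDb]; exact hφi⟩
  rcases lt_trichotomy s 0 with hs0 | rfl | hs0
  · exfalso
    have hL := (image_halfLines_left_of_neg hγ h φ hφ0 hφi hs0 hs).1
    have hΩ := (image_halfLines_of_pos Φ hΦ htL ht).1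
    exact false_of_image_Iio_subset_image_Ioi φ Φ hφ hΦ (left_subset_carrier h) hDa
      (hL.trans_subset hΩ.symm.subset)
  · exfalso
    have h0 := JordanDomain.boundaryExtension_eq_of_hasBoundaryValue' φ (by simp) hs
    rw [boundaryExtension_zero_of_isChordalUniformizing φ hφ, hDa] at h0
    exact absurd (Q.pt_injective h0) (by decide)
  · exact hs0

include hγ hΦ htL in
/-- **Orientation rule, left bank, `t_L < 0`**: the real point over `c_L` is negative. [folklore] -/
theorem sign_left_neg {L R : Set ℂ}
    (h : L ∪ R = Q.carrier \ γ.range ∧ Disjoint L R ∧ IsOpen L ∧ IsOpen R ∧ IsConnected L ∧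
      IsConnected R ∧ Q.pt 1 ∈ closure L ∧ Q.pt 3 ∈ closure R)
    (φ : ConformalEquiv upperHalfPlaneSet L) (hφ0 : φ.HasBoundaryValue 0 (Q.pt 0))
    (hφi : φ.HasBoundaryValueAtInfty (Q.pt 2)) (ht : tL < 0) {s : ℝ}
    (hs : φ.HasBoundaryValue s (Q.pt 1)) : s < 0 := by
  obtain ⟨p, hp, hpinj, hprange, hp0, hp1⟩ := exists_param_of_isSimpleChord hγ
  obtain ⟨D, hDL, hDa, hDb, -⟩ := exists_leftBank_dobrushinDomain hγ h hp hpinj hprange hp0 hp1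
  subst hDL
  have hφ : D.IsChordalUniformizing φ := ⟨by rw [hDa]; exact hφ0, by rw [hDb]; exact hφi⟩
  rcases lt_trichotomy s 0 with hs0 | rfl | hs0
  · exact hs0
  · exfalso
    have h0 := JordanDomain.boundaryExtension_eq_of_hasBoundaryValue' φ (by simp) hs
    rw [boundaryExtension_zero_of_isChordalUniformizing φ hφ, hDa] at h0
    exact absurd (Q.pt_injective h0) (by decide)
  · exfalso
    have hL := (image_halfLines_left_of_pos hγ h φ hφ0 hφi hs0 hs).1
    have hΩ := (image_halfLines_of_neg Φ hΦ htL ht).1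
    exact false_of_image_Ioi_subset_image_Iio φ Φ hφ hΦ (left_subset_carrier h) hDa
      (hL.trans_subset hΩ.symm.subset)

include hγ hΦ htL in
/-- **Orientation rule, right bank, `t_L > 0`**: if `ψ : ℍ → R` has boundary values `a` at `0`,
`b` at `∞` and `c_R` at the real point `s`, then `s < 0`. [folklore] -/
theorem sign_right_pos {L R : Set ℂ}
    (h : L ∪ R = Q.carrier \ γ.range ∧ Disjoint L R ∧ IsOpen L ∧ IsOpen R ∧ IsConnected L ∧
      IsConnected R ∧ Q.pt 1 ∈ closure L ∧ Q.pt 3 ∈ closure R)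
    (ψ : ConformalEquiv upperHalfPlaneSet R) (hψ0 : ψ.HasBoundaryValue 0 (Q.pt 0))
    (hψi : ψ.HasBoundaryValueAtInfty (Q.pt 2)) (ht : 0 < tL) {s : ℝ}
    (hs : ψ.HasBoundaryValue s (Q.pt 3)) : s < 0 := by
  obtain ⟨p, hp, hpinj, hprange, hp0, hp1⟩ := exists_param_of_isSimpleChord hγ
  obtain ⟨D, hDR, hDa, hDb, -⟩ := exists_rightBank_dobrushinDomain hγ h hp hpinj hprange hp0 hp1
  subst hDR
  have hψ : D.IsChordalUniformizing ψ := ⟨by rw [hDa]; exact hψ0, by rw [hDb]; exact hψi⟩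
  rcases lt_trichotomy s 0 with hs0 | rfl | hs0
  · exact hs0
  · exfalso
    have h0 := JordanDomain.boundaryExtension_eq_of_hasBoundaryValue' ψ (by simp) hs
    rw [boundaryExtension_zero_of_isChordalUniformizing ψ hψ, hDa] at h0
    exact absurd (Q.pt_injective h0) (by decide)
  · exfalso
    have hR := (image_halfLines_right_of_pos hγ h ψ hψ0 hψi hs0 hs).1
    have hΩ := (image_halfLines_of_pos Φ hΦ htL ht).2
    exact false_of_image_Ioi_subset_image_Iio ψ Φ hψ hΦ (right_subset_carrier h) hDa
      (hR.trans_subset hΩ.symm.subset)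

include hγ hΦ htL in
/-- **Orientation rule, right bank, `t_L < 0`**: the real point over `c_R` is positive.
[folklore] -/
theorem sign_right_neg {L R : Set ℂ}
    (h : L ∪ R = Q.carrier \ γ.range ∧ Disjoint L R ∧ IsOpen L ∧ IsOpen R ∧ IsConnected L ∧
      IsConnected R ∧ Q.pt 1 ∈ closure L ∧ Q.pt 3 ∈ closure R)
    (ψ : ConformalEquiv upperHalfPlaneSet R) (hψ0 : ψ.HasBoundaryValue 0 (Q.pt 0))
    (hψi : ψ.HasBoundaryValueAtInfty (Q.pt 2)) (ht : tL < 0) {s : ℝ}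
    (hs : ψ.HasBoundaryValue s (Q.pt 3)) : 0 < s := by
  obtain ⟨p, hp, hpinj, hprange, hp0, hp1⟩ := exists_param_of_isSimpleChord hγ
  obtain ⟨D, hDR, hDa, hDb, -⟩ := exists_rightBank_dobrushinDomain hγ h hp hpinj hprange hp0 hp1
  subst hDR
  have hψ : D.IsChordalUniformizing ψ := ⟨by rw [hDa]; exact hψ0, by rw [hDb]; exact hψi⟩
  rcases lt_trichotomy s 0 with hs0 | rfl | hs0
  · exfalso
    have hR := (image_halfLines_right_of_neg hγ h ψ hψ0 hψi hs0 hs).1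
    have hΩ := (image_halfLines_of_neg Φ hΦ htL ht).2
    exact false_of_image_Iio_subset_image_Ioi ψ Φ hψ hΦ (right_subset_carrier h) hDa
      (hR.trans_subset hΩ.symm.subset)
  · exfalso
    have h0 := JordanDomain.boundaryExtension_eq_of_hasBoundaryValue' ψ (by simp) hs
    rw [boundaryExtension_zero_of_isChordalUniformizing ψ hψ, hDa] at h0
    exact absurd (Q.pt_injective h0) (by decide)
  · exact hs0

end Banks

/-! ### The reference point `t_L` -/

/-- **The real point over `c_L`.** A chordal uniformiser `Φ : (ℍ; 0, ∞) → (Ω; a, b)` of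
`Q.chord 0 2` takes the value `c_L = Q.pt 1` at exactly one real point `t_L`, and `t_L ≠ 0`
(Carathéodory's boundary correspondence). [folklore] -/
theorem exists_boundaryExtension_eq_pt_one {Q : ConformalRectangle}
    (Φ : ConformalEquiv upperHalfPlaneSet (Q.chord 0 2 (by decide)).carrier)
    (hΦ : (Q.chord 0 2 (by decide)).IsChordalUniformizing Φ) :
    ∃ tL : ℝ, tL ≠ 0 ∧ Φ.boundaryExtension tL = Q.pt 1 :=
  exists_ne_zero_boundaryExtension_eq Φ hΦ (Q.pt_mem_frontier 1)
    (fun h => absurd (Q.pt_injective h) (by decide)) (fun h => absurd (Q.pt_injective h) (by decide))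

end Summit.CriticalPhenomena.SAWScalingLimit.Theorems
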